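import Summits.ResolutionOfSingularities.ResolutionOfSingularities.Theorems.EquisingularLiftEquisingularLiftNatDirectionCentreSection
import Summits.ResolutionOfSingularities.ResolutionOfSingularities.Theorems.EquisingularLiftEquisingularLiftNatCarrierDeltaOffVertex
import HarnessLib

/-!
# [OURS · L1 W4.5(b) · EL♮(3)] T-DIRLIFT part B0 — SECTIONS ARE DIRECTION CENTRES, POINTWISE:
# a section germ of the exceptional divisor over `z` is the stalk of `controlledTransform υ J 𝒟 1` for a re-framed direction `𝒟`

Crux chain w45b (cell `res-hironaka`, slot W4.5(b)), working crux **EL♮** = stmt-ResolutionOfSingularities-20038, child **EL♮(3)** =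
stmt-ResolutionOfSingularities-20148, route EquisingularLift, line `sections`; supplier object **T-DIRLIFT** (plan-1 CHAIN v7.24 O2),
first piece of part B (the downstairs dictionary «`DirStepSec` section `Γ` ↦ direction», pv-051's DIR₀₀ census brick (D)(i)).
HONEST FRAMING: OURS; NOT a statement of any manuscript; AI-written, weaker than expert review. No `sorry`; standard axioms. DEF-FREE.
`--supports stmt-ResolutionOfSingularities-20148 --as helper`.

SETTING. `υ : G₁ → G` a blowing up along `J` (downstairs: the carrier curve `Z = V(J)`), `y ∈ G₁` over `z`, a quasi-regular frame
`J_z = (c 0, c 1)`, and an ideal `P ⊆ 𝔪_y` of `𝒪_{G₁,y}` which is a SECTION GERM: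
`E_y ⊆ P` and `𝒪_{G,z} → 𝒪_{G₁,y} ⧸ P` is surjective with kernel inside `J_z` (for `P = 𝓘_Γ,y` this is `DirStepSec` read at `y`:
`Γ̃_red ≅ Z̃_red` through `υ`).

WHAT.
* `isQuasiRegular_reframe` — quasi-regularity of `(c 0, c 1)` passes to `(c o − μ c i, c i)` (linear substitution in Matsumura's definition).
* `map_directionCentre_eq_of_le_of_comap_le` — ring level: an ideal `P` of `B_𝔔` between `𝔞B_𝔔` and with `P ∩ A ⊆ I` IS `𝔞B_𝔔`
  (…NatDirectionCentreChartRing: `A ↠ B_𝔔 ⧸ 𝔞B_𝔔` with kernel `I`).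
* `stalkIdeal_directionCentre_eq_of_section_of_chart` — with a chart-`c i` presentation and `μ ∈ 𝒪_{G,z}` such that
  `χ(c_o/c_i) ≡ μ (mod P)`: for EVERY ideal sheaf `𝒟` with `𝒟_z = (c o − μ c i) + (c i)²` one has `(controlledTransform υ J 𝒟 1)_y = P`.
* **`exists_frame_stalkIdeal_directionCentre_eq_of_section`** — hence there is a re-framing `c' = (c o − μ c i, c i)` of `J_z` such that
  every direction `𝒟` with `𝒟_z = (c' 0) + (c' 1)²` has direction-centre stalk `P` at `y` («the section value `T = μ` becomes `T′ = 0`»).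

References: The Stacks Project, Tag 0804 — through the tree (T-PTPRIME p540294/p541669: `exists_chartPresentation_of_eq`,
`exists_prescribedChartPresentation_of_eq`, `stalkIdeal_comap_eq_span_of_chartPresentation`, `mem_nonZeroDivisors_of_stalkIdeal_comap_eq_span`,
`mem_chartPrime_iff_apply_mem_maximalIdeal`, `apply_frac_mul`; T-DIRLIFT D1/D3: `stalkIdeal_directionCentre_eq_map`,
`surjective_mk_map_directionCentre_comp`, `comap_map_directionCentre`).
-/

set_option linter.dupNamespace false -- mandated namespace `Summit.<Summit>.<Problem>` of this single-conjunct summit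

noncomputable section

open CategoryTheory CategoryTheory.Limits AlgebraicGeometry TopologicalSpace IsLocalRing
open Literature.AlgebraicGeometry.Resolution
open AlgebraicGeometry.Scheme.IdealSheafData

namespace Summit.ResolutionOfSingularities.ResolutionOfSingularities.Cruxes.EquisingularLiftNat.Sections

universe u

/-! ## 1. Ring level: an ideal squeezed between `𝔞B_𝔔` and `I` on `A` is `𝔞B_𝔔` -/

section Chart

variable {A : Type u} [CommRing A] {r : ℕ} (x : Fin r → A) (i : Fin r)
variable {S : Type*} [CommRing S] [Algebra (blowupAlgebra (Ideal.span (Set.range x)) (x i)) S]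

/-- **An ideal `P ⊇ 𝔞B_𝔔` with `P ∩ A ⊆ I` equals `𝔞B_𝔔`** (`A` local, `x` quasi-regular, `𝔔 ⊇ 𝔞` over `𝔪_A`, `S = B_𝔔`): every
`s ∈ P` is `≡ a/1 (mod 𝔞B_𝔔)` with `a ∈ P ∩ A ⊆ I ⊆ 𝔞 ∩ A`. [folklore] -/
theorem map_directionCentre_eq_of_le_of_comap_le [IsLocalRing A] (hx : IsQuasiRegular x)
    (𝔔 : Ideal (blowupAlgebra (Ideal.span (Set.range x)) (x i))) [𝔔.IsPrime] [IsLocalization.AtPrime S 𝔔]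
    (h𝔞𝔔 : Ideal.span {algebraMap A (blowupAlgebra (Ideal.span (Set.range x)) (x i)) (x i)} ⊔
        Ideal.span (Set.range fun j : {j : Fin r // j ≠ i} => blowupAlgebra.frac x i j.1) ≤ 𝔔)
    (h𝔔 : 𝔔.comap (algebraMap A _) = maximalIdeal A) (P : Ideal S)
    (h𝔞P : (Ideal.span {algebraMap A (blowupAlgebra (Ideal.span (Set.range x)) (x i)) (x i)} ⊔
        Ideal.span (Set.range fun j : {j : Fin r // j ≠ i} => blowupAlgebra.frac x i j.1)).map
          (algebraMap (blowupAlgebra (Ideal.span (Set.range x)) (x i)) S) ≤ P)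
    (hker : P.comap ((algebraMap (blowupAlgebra (Ideal.span (Set.range x)) (x i)) S).comp (algebraMap A _)) ≤
      Ideal.span (Set.range x)) :
    (Ideal.span {algebraMap A (blowupAlgebra (Ideal.span (Set.range x)) (x i)) (x i)} ⊔
        Ideal.span (Set.range fun j : {j : Fin r // j ≠ i} => blowupAlgebra.frac x i j.1)).map
          (algebraMap (blowupAlgebra (Ideal.span (Set.range x)) (x i)) S) = P := by
  refine le_antisymm h𝔞P fun s hs => ?_
  obtain ⟨a, ha⟩ := surjective_mk_map_directionCentre_comp (S := S) x i 𝔔 h𝔞𝔔 h𝔔 (Ideal.Quotient.mk _ s)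
  rw [RingHom.comp_apply, Ideal.Quotient.mk_eq_mk_iff_sub_mem] at ha
  -- `a ∈ P ∩ A ⊆ I = 𝔞B_𝔔 ∩ A`
  have haP : ((algebraMap (blowupAlgebra (Ideal.span (Set.range x)) (x i)) S).comp (algebraMap A _)) a ∈ P := by
    have h' : ((algebraMap (blowupAlgebra (Ideal.span (Set.range x)) (x i)) S).comp (algebraMap A _)) a =
        s + (((algebraMap (blowupAlgebra (Ideal.span (Set.range x)) (x i)) S).comp (algebraMap A _)) a - s) := by ring
    rw [h']
    exact P.add_mem hs (h𝔞P ha)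
  have haI : a ∈ Ideal.span (Set.range x) := hker (Ideal.mem_comap.mpr haP)
  have ha𝔞 : ((algebraMap (blowupAlgebra (Ideal.span (Set.range x)) (x i)) S).comp (algebraMap A _)) a ∈
      (Ideal.span {algebraMap A (blowupAlgebra (Ideal.span (Set.range x)) (x i)) (x i)} ⊔
        Ideal.span (Set.range fun j : {j : Fin r // j ≠ i} => blowupAlgebra.frac x i j.1)).map
          (algebraMap (blowupAlgebra (Ideal.span (Set.range x)) (x i)) S) := by
    rw [← Ideal.mem_comap, comap_map_directionCentre x i hx 𝔔 h𝔞𝔔 h𝔔]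
    exact haI
  have h' : s = ((algebraMap (blowupAlgebra (Ideal.span (Set.range x)) (x i)) S).comp (algebraMap A _)) a -
      (((algebraMap (blowupAlgebra (Ideal.span (Set.range x)) (x i)) S).comp (algebraMap A _)) a - s) := by ring
  rw [h']
  exact Ideal.sub_mem _ ha𝔞 ha

end Chart

/-! ## 2. Scheme level: a section germ is a direction-centre stalk -/

section Section

variable {G₁ G : Scheme.{u}} {υ : G₁ ⟶ G} {J : G.IdealSheafData}

/-- Re-framing a pair: `(c o − μ c i, c i)` spans the same ideal as `(c 0, c 1)` (`o ≠ i` in `Fin 2`). [folklore] -/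
theorem span_range_reframe_eq {R : Type u} [CommRing R] (c : Fin 2 → R) (i o : Fin 2) (hoi : o ≠ i) (μ : R) :
    Ideal.span (Set.range ![c o - μ * c i, c i]) = Ideal.span (Set.range c) := by
  have hio : ∀ k : Fin 2, k = i ∨ k = o := by
    intro k; rcases Fin.exists_fin_two.mp ⟨k, rfl⟩ with h | h <;> rcases Fin.exists_fin_two.mp ⟨i, rfl⟩ with hi | hi <;>
      rcases Fin.exists_fin_two.mp ⟨o, rfl⟩ with ho | ho <;> simp_all
  apply le_antisymm
  · rw [Ideal.span_le, Set.range_subset_iff]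
    intro k
    rcases Fin.exists_fin_two.mp ⟨k, rfl⟩ with hk | hk
    · rw [hk]
      simp only [Matrix.cons_val_zero, SetLike.mem_coe]
      exact Ideal.sub_mem _ (Ideal.subset_span ⟨o, rfl⟩) (Ideal.mul_mem_left _ _ (Ideal.subset_span ⟨i, rfl⟩))
    · rw [hk]
      simp only [Matrix.cons_val_one, SetLike.mem_coe]
      exact Ideal.subset_span ⟨i, rfl⟩
  · rw [Ideal.span_le, Set.range_subset_iff]
    intro k
    have hi : c i ∈ Ideal.span (Set.range ![c o - μ * c i, c i]) :=
      Ideal.subset_span ⟨1, by simp⟩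
    have ho : c o ∈ Ideal.span (Set.range ![c o - μ * c i, c i]) := by
      have h : (c o - μ * c i) + μ * c i ∈ Ideal.span (Set.range ![c o - μ * c i, c i]) :=
        Ideal.add_mem _ (Ideal.subset_span ⟨0, rfl⟩) (Ideal.mul_mem_left _ _ hi)
      rwa [sub_add_cancel] at h
    rcases hio k with hk | hk <;> rw [SetLike.mem_coe, hk] <;> assumption

/-- **Quasi-regularity is invariant under re-framing a pair**: `(c 0, c 1)` quasi-regular ⇒ `(c o − μ c i, c i)` quasi-regular
(`o ≠ i`). The substitution `Y₀ ↦ X_o − μ X_i`, `Y₁ ↦ X_i` is a degree-preserving automorphism of `R[X₀, X₁]` fixing `I·R[X]`.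
[cite: Matsumura1987, §16 Definition p. 124] -/
theorem isQuasiRegular_reframe {R : Type u} [CommRing R] (c : Fin 2 → R) (hc : IsQuasiRegular c) (i o : Fin 2) (hoi : o ≠ i)
    (μ : R) : IsQuasiRegular ![c o - μ * c i, c i] := by
  classical
  have hio : ∀ k : Fin 2, k ≠ i → k = o := by
    intro k hk; rcases Fin.exists_fin_two.mp ⟨k, rfl⟩ with h | h <;> rcases Fin.exists_fin_two.mp ⟨i, rfl⟩ with hi | hi <;>
      rcases Fin.exists_fin_two.mp ⟨o, rfl⟩ with ho | ho <;> simp_all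
  have hI : Ideal.span (Set.range ![c o - μ * c i, c i]) = Ideal.span (Set.range c) := span_range_reframe_eq c i o hoi μ
  -- the substitution and its inverse
  let g : Fin 2 → MvPolynomial (Fin 2) R := ![MvPolynomial.X o - MvPolynomial.C μ * MvPolynomial.X i, MvPolynomial.X i]
  let g' : Fin 2 → MvPolynomial (Fin 2) R := fun k =>
    if k = i then MvPolynomial.X 1 else MvPolynomial.X 0 + MvPolynomial.C μ * MvPolynomial.X 1
  have hg1 : ∀ k, (g k).IsHomogeneous 1 := by
    intro k
    rcases Fin.exists_fin_two.mp ⟨k, rfl⟩ with hk | hk <;> rw [hk]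
    · exact (MvPolynomial.isHomogeneous_X R o).sub ((MvPolynomial.isHomogeneous_X R i).C_mul μ)
    · exact MvPolynomial.isHomogeneous_X R i
  have hgeval : ∀ k, MvPolynomial.eval c (g k) = ![c o - μ * c i, c i] k := by
    intro k
    rcases Fin.exists_fin_two.mp ⟨k, rfl⟩ with hk | hk <;> rw [hk] <;> simp [g]
  have hg'i : g' i = MvPolynomial.X 1 := by simp [g']
  have hg'o : g' o = MvPolynomial.X 0 + MvPolynomial.C μ * MvPolynomial.X 1 := by simp [g', hoi]
  have hg'g : ∀ k, MvPolynomial.bind₁ g' (g k) = MvPolynomial.X k := by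
    intro k
    rcases Fin.exists_fin_two.mp ⟨k, rfl⟩ with hk | hk <;> rw [hk]
    · simp only [g, Matrix.cons_val_zero, map_sub, map_mul, MvPolynomial.bind₁_X_right, MvPolynomial.bind₁_C_right, hg'i, hg'o]
      ring
    · simp [g, hg'i]
  intro n F hF hmem
  -- move to the frame `c`
  have hF1 : (MvPolynomial.bind₁ g F).IsHomogeneous n := by
    have h := hF.aeval g hg1
    rwa [one_mul] at h
  have heval : MvPolynomial.eval c (MvPolynomial.bind₁ g F) = MvPolynomial.eval ![c o - μ * c i, c i] F := by
    change MvPolynomial.eval₂Hom (RingHom.id R) c (MvPolynomial.bind₁ g F) = _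
    rw [MvPolynomial.eval₂Hom_bind₁]
    have h : (fun k => MvPolynomial.eval₂Hom (RingHom.id R) c (g k)) = ![c o - μ * c i, c i] := funext fun k => hgeval k
    rw [h]
    rfl
  have hmem1 : MvPolynomial.eval c (MvPolynomial.bind₁ g F) ∈ Ideal.span (Set.range c) ^ (n + 1) := by
    rw [heval, ← hI]; exact hmem
  have h1 := hc n _ hF1 hmem1
  -- come back with the inverse substitution
  have h2 : MvPolynomial.bind₁ g' (MvPolynomial.bind₁ g F) ∈
      Ideal.map (MvPolynomial.C : R →+* MvPolynomial (Fin 2) R) (Ideal.span (Set.range c)) := by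
    have hle : (Ideal.map (MvPolynomial.C : R →+* MvPolynomial (Fin 2) R) (Ideal.span (Set.range c))).map
        (MvPolynomial.bind₁ g').toRingHom ≤ Ideal.map MvPolynomial.C (Ideal.span (Set.range c)) := by
      rw [Ideal.map_map, Ideal.map_le_iff_le_comap]
      intro r hr
      rw [Ideal.mem_comap, RingHom.comp_apply]
      change MvPolynomial.bind₁ g' (MvPolynomial.C r) ∈ _
      rw [MvPolynomial.bind₁_C_right]
      exact Ideal.mem_map_of_mem _ hr
    exact hle (Ideal.mem_map_of_mem _ h1)
  have h3 : MvPolynomial.bind₁ g' (MvPolynomial.bind₁ g F) = F := by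
    rw [MvPolynomial.bind₁_bind₁]
    have hX : (fun k => MvPolynomial.bind₁ g' (g k)) = MvPolynomial.X := funext hg'g
    rw [hX, MvPolynomial.bind₁_X_left]
    rfl
  rw [h3] at h2
  rwa [hI]

/-- **A section germ is a direction-centre stalk (chart form).** `υ : G₁ → G` a blowing up along `J`, `y` over `z` presented on the chart
`c i` of a quasi-regular frame `J_z = (c 0, c 1)`, `P ⊆ 𝔪_y` an ideal containing `E_y` with `P ∩ 𝒪_{G,z} ⊆ J_z`, and
`μ ∈ 𝒪_{G,z}` with `χ(c_o/c_i) ≡ μ (mod P)`. Then for every `𝒟` with `𝒟_z = (c o − μ·c i) + (c i)²`: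
`(controlledTransform υ J 𝒟 1)_y = P`. [cite: StacksProject, Tag 0804] -/
theorem stalkIdeal_directionCentre_eq_of_section_of_chart (hυ : IsBlowup υ J) (y : G₁) {z : G} (hy : υ y = z)
    (c : Fin 2 → G.presheaf.stalk z) (hc : Ideal.span (Set.range c) = stalkIdeal J z)
    (hqr : IsQuasiRegular c)
    (i o : Fin 2) (hoi : o ≠ i)
    (χ : blowupAlgebra (Ideal.span (Set.range c)) (c i) →+* G₁.presheaf.stalk y)
    (hχ : ∀ a, χ (algebraMap _ _ a) = ((G.presheaf.stalkCongr (.of_eq hy)).inv ≫ υ.stalkMap y).hom a)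
    (P : Ideal (G₁.presheaf.stalk y)) (hP : P ≤ maximalIdeal _) (hEP : stalkIdeal (J.comap υ) y ≤ P)
    (hker : P.comap ((G.presheaf.stalkCongr (.of_eq hy)).inv ≫ υ.stalkMap y).hom ≤ stalkIdeal J z)
    (μ : G.presheaf.stalk z)
    (hμ : χ (blowupAlgebra.frac c i o) - ((G.presheaf.stalkCongr (.of_eq hy)).inv ≫ υ.stalkMap y).hom μ ∈ P)
    (𝒟 : G.IdealSheafData) (h𝒟 : stalkIdeal 𝒟 z = Ideal.span {c o - μ * c i} ⊔ Ideal.span {c i * c i}) :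
    stalkIdeal (controlledTransform υ J 𝒟 1) y = P := by
  -- the re-framed frame `c' = (c o − μ c i, c i)`
  have hc' : Ideal.span (Set.range ![c o - μ * c i, c i]) = stalkIdeal J z := by rw [span_range_reframe_eq c i o hoi μ, hc]
  have hE : stalkIdeal (J.comap υ) y = Ideal.span {((G.presheaf.stalkCongr (.of_eq hy)).inv ≫ υ.stalkMap y).hom (c i)} :=
    stalkIdeal_comap_eq_span_of_chartPresentation y hy c hc i χ hχ
  have hE' : stalkIdeal (J.comap υ) y =
      Ideal.span {((G.presheaf.stalkCongr (.of_eq hy)).inv ≫ υ.stalkMap y).hom (![c o - μ * c i, c i] 1)} := by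
    rw [hE]; simp
  have hnzd := mem_nonZeroDivisors_of_stalkIdeal_comap_eq_span hυ y hE
  -- a presentation on the chart `c' 1 = c i` of the new frame
  obtain ⟨𝔔', χ', hχ', hloc', h𝔔'⟩ := exists_prescribedChartPresentation_of_eq hυ y hy (![c o - μ * c i, c i]) hc' 1 hE'
  have h𝒟' : stalkIdeal 𝒟 z = Ideal.span {![c o - μ * c i, c i] 0} ⊔ Ideal.span {![c o - μ * c i, c i] 1 * ![c o - μ * c i, c i] 1} := by
    rw [h𝒟]; simp
  rw [stalkIdeal_directionCentre_eq_map hυ 𝒟 y hy _ hc' h𝒟' χ' hχ']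
  letI := χ'.toAlgebra
  haveI : IsLocalization.AtPrime (G₁.presheaf.stalk y) 𝔔'.asIdeal := hloc'
  have hT : (algebraMap _ (G₁.presheaf.stalk y)).comp (algebraMap _ (blowupAlgebra (Ideal.span (Set.range ![c o - μ * c i, c i]))
      (![c o - μ * c i, c i] 1))) = ((G.presheaf.stalkCongr (.of_eq hy)).inv ≫ υ.stalkMap y).hom := RingHom.ext fun a => hχ' a
  -- the new fraction is the old one minus `μ`, hence in `P`
  have hfrac' : χ' (blowupAlgebra.frac ![c o - μ * c i, c i] 1 0) =
      χ (blowupAlgebra.frac c i o) - ((G.presheaf.stalkCongr (.of_eq hy)).inv ≫ υ.stalkMap y).hom μ := by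
    have h1 := apply_frac_mul (![c o - μ * c i, c i]) 1 0 χ' _ hχ'
    have h2 := apply_frac_mul c i o χ _ hχ
    have h1' : χ' (blowupAlgebra.frac ![c o - μ * c i, c i] 1 0) * ((G.presheaf.stalkCongr (.of_eq hy)).inv ≫ υ.stalkMap y).hom (c i) =
        ((G.presheaf.stalkCongr (.of_eq hy)).inv ≫ υ.stalkMap y).hom (c o - μ * c i) := h1
    rw [map_sub, map_mul] at h1'
    have h3 : (χ' (blowupAlgebra.frac ![c o - μ * c i, c i] 1 0) -
        (χ (blowupAlgebra.frac c i o) - ((G.presheaf.stalkCongr (.of_eq hy)).inv ≫ υ.stalkMap y).hom μ)) *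
        ((G.presheaf.stalkCongr (.of_eq hy)).inv ≫ υ.stalkMap y).hom (c i) = 0 := by
      linear_combination h1' - h2
    exact sub_eq_zero.mp ((mem_nonZeroDivisors_iff_right.mp hnzd) _ h3)
  -- `𝔞'·𝒪_y ≤ P`
  have h𝔞P : (Ideal.span {algebraMap _ (blowupAlgebra (Ideal.span (Set.range ![c o - μ * c i, c i])) (![c o - μ * c i, c i] 1))
      (![c o - μ * c i, c i] 1)} ⊔ Ideal.span (Set.range fun j : {j : Fin 2 // j ≠ 1} =>
        blowupAlgebra.frac ![c o - μ * c i, c i] 1 j.1)).map (algebraMap _ (G₁.presheaf.stalk y)) ≤ P := by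
    rw [Ideal.map_le_iff_le_comap]
    refine sup_le ?_ ?_
    · rw [Ideal.span_singleton_le_iff_mem, Ideal.mem_comap]
      change χ' (algebraMap _ _ _) ∈ P
      rw [hχ']
      apply hEP
      rw [hE']
      exact Ideal.mem_span_singleton_self _
    · rw [Ideal.span_le]
      rintro _ ⟨⟨j, hj⟩, rfl⟩
      have hj0 : j = 0 := by omega
      subst hj0
      rw [SetLike.mem_coe, Ideal.mem_comap]
      change χ' (blowupAlgebra.frac _ 1 0) ∈ P
      rw [hfrac']
      exact hμ
  have h𝔞𝔔 : Ideal.span {algebraMap _ (blowupAlgebra (Ideal.span (Set.range ![c o - μ * c i, c i])) (![c o - μ * c i, c i] 1))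
      (![c o - μ * c i, c i] 1)} ⊔ Ideal.span (Set.range fun j : {j : Fin 2 // j ≠ 1} =>
        blowupAlgebra.frac ![c o - μ * c i, c i] 1 j.1) ≤ 𝔔'.asIdeal := by
    intro b hb
    rw [mem_chartPrime_iff_apply_mem_maximalIdeal 𝔔' χ' hloc']
    exact hP (h𝔞P (Ideal.mem_map_of_mem _ hb))
  refine map_directionCentre_eq_of_le_of_comap_le (S := G₁.presheaf.stalk y) _ 1 (isQuasiRegular_reframe c hqr i o hoi μ)
    𝔔'.asIdeal h𝔞𝔔 h𝔔' P h𝔞P ?_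
  rw [hT, hc']
  exact hker

/-- **A section germ is a direction-centre stalk, after re-framing.** `υ : G₁ → G` a blowing up along `J`, `y` over `z`, `J_z = (c 0, c 1)`
a quasi-regular frame, `P ⊆ 𝔪_y` an ideal with `E_y ⊆ P`,
`𝒪_{G,z} ↠ 𝒪_{G₁,y} ⧸ P` and `P ∩ 𝒪_{G,z} ⊆ J_z` (a SECTION GERM, e.g. `P = 𝓘_Γ,y` for a `DirStepSec` section `Γ`). Then there is a
frame `c'` of `J_z` such that EVERY ideal sheaf `𝒟` with `𝒟_z = (c' 0) + (c' 1)²` has `(controlledTransform υ J 𝒟 1)_y = P`.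
[cite: StacksProject, Tag 0804] -/
theorem exists_frame_stalkIdeal_directionCentre_eq_of_section (hυ : IsBlowup υ J) (y : G₁) {z : G} (hy : υ y = z)
    (c : Fin 2 → G.presheaf.stalk z) (hc : Ideal.span (Set.range c) = stalkIdeal J z)
    (hqr : IsQuasiRegular c)
    (P : Ideal (G₁.presheaf.stalk y)) (hP : P ≤ maximalIdeal _) (hEP : stalkIdeal (J.comap υ) y ≤ P)
    (hsurj : Function.Surjective ((Ideal.Quotient.mk P).comp ((G.presheaf.stalkCongr (.of_eq hy)).inv ≫ υ.stalkMap y).hom))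
    (hker : P.comap ((G.presheaf.stalkCongr (.of_eq hy)).inv ≫ υ.stalkMap y).hom ≤ stalkIdeal J z) :
    ∃ c' : Fin 2 → G.presheaf.stalk z, Ideal.span (Set.range c') = stalkIdeal J z ∧
      ∀ 𝒟 : G.IdealSheafData, stalkIdeal 𝒟 z = Ideal.span {c' 0} ⊔ Ideal.span {c' 1 * c' 1} →
        stalkIdeal (controlledTransform υ J 𝒟 1) y = P := by
  obtain h := exists_chartPresentation_of_eq hυ y hy c hc
  -- the chart index `i` and the other index `o`
  have key : ∀ (i o : Fin 2) (hoi : o ≠ i) (χ : blowupAlgebra (Ideal.span (Set.range c)) (c i) →+* G₁.presheaf.stalk y)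
      (hχ : ∀ a, χ (algebraMap _ _ a) = ((G.presheaf.stalkCongr (.of_eq hy)).inv ≫ υ.stalkMap y).hom a),
      ∃ c' : Fin 2 → G.presheaf.stalk z, Ideal.span (Set.range c') = stalkIdeal J z ∧
        ∀ 𝒟 : G.IdealSheafData, stalkIdeal 𝒟 z = Ideal.span {c' 0} ⊔ Ideal.span {c' 1 * c' 1} →
          stalkIdeal (controlledTransform υ J 𝒟 1) y = P := by
    intro i o hoi χ hχ
    obtain ⟨μ, hμ⟩ := hsurj (Ideal.Quotient.mk P (χ (blowupAlgebra.frac c i o)))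
    rw [RingHom.comp_apply, Ideal.Quotient.mk_eq_mk_iff_sub_mem] at hμ
    have hμ' : χ (blowupAlgebra.frac c i o) - ((G.presheaf.stalkCongr (.of_eq hy)).inv ≫ υ.stalkMap y).hom μ ∈ P := by
      rw [← neg_sub]; exact P.neg_mem hμ
    refine ⟨![c o - μ * c i, c i], by rw [span_range_reframe_eq c i o hoi μ, hc], fun 𝒟 h𝒟 => ?_⟩
    refine stalkIdeal_directionCentre_eq_of_section_of_chart hυ y hy c hc hqr i o hoi χ hχ P hP hEP hker μ hμ' 𝒟 ?_
    rw [h𝒟]; simp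
  rcases Fin.exists_fin_two.mp h with ⟨𝔔, χ, hχ, -, -⟩ | ⟨𝔔, χ, hχ, -, -⟩
  · exact key 0 1 (by decide) χ hχ
  · exact key 1 0 (by decide) χ hχ

end Section

end Summit.ResolutionOfSingularities.ResolutionOfSingularities.Cruxes.EquisingularLiftNat.Sections

end
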